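import Summits.QuantumFields.YangMills.Theorems.ColdStartUniversalityLatticeLangevinRiemannLipschitz
import HarnessLib

/-!
# Shen–Zhu–Zhu's Theorem 4.2 (4.5) as a CONTRACTION OF THE `ρ_L`-LIPSCHITZ SEMINORM, uniformly in the volume:
# `Lip_(ρ_L)(P_t F) ≤ e^(−(1−12|β'|)t) · Lip_(ρ_L)(F)` for the `SU(2)` lattice Langevin dynamics on `(ℤ/L)³`, `|β'| < 1/12`

Seat `ym-line-csu-p1` (g41), route `ColdStartUniversality` of `Summits/QuantumFields/YangMills`, helper file G44 (`--supports stmt-QuantumFields-24809`).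
G42/G43 (`…RiemannLipschitz`, `…RiemannContraction`) turned the seat's gradient bound into `|P_tF(Q) − P_tF(Q')| ≤ e^(−Kt)·√(sup Γ^A(f)/2)·ρ_L(Q,Q')`.  This file closes the loop with the
CONVERSE `ρ_L`-Lipschitz ⇒ `Γ^A ≤ 2·Lip²` (the Riemannian gradient of a Lipschitz function is bounded by its Lipschitz constant), so that the input
and the output are the same quantity — the Lipschitz seminorm for Shen–Zhu–Zhu's Riemannian distance `ρ_L`:

* ★ `hasDerivAt_comp_coords_prodFlow_two` — derivative of `s ↦ f(coords((e^(sX_e) V_e)_e))` along a product one-parameter flow, `X_e ∈ 𝔰𝔲(2)`;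
* ★ `torusRiemannDistSq_prodFlow_le` — `ρ_L(V, (e^(sX_e)V_e)_e)² ≤ s²·Σ_e|X_e|²`;
* ★★ `carre_le_two_mul_sq_of_riemannLipschitz` — if `|f(coords Q') − f(coords Q)| ≤ L_f·ρ_L(Q,Q')` for all `Q, Q'` then `Γ^A(f) ≤ 2 L_f²` on `SU(2)^E`
  (test the Lipschitz bound along the flow generated by the gradient itself, `X_e = Σ_ν √2·(W_(e,ν)f)·𝐩(E_ν)`);
* ★★★ `wilson_riemannLipschitz_contraction_uniform` — **for `|β'| < 1/12`, every `L`, every realising kernel family, every `C⁵` `f` which is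
  `L_f`-Lipschitz in `ρ_L` on the group, every `t ≥ 0`, `Q`, `Q'`:  `|∫ f∘coords dκ_t(Q) − ∫ f∘coords dκ_t(Q')| ≤ e^(−(1−12|β'|)t)·L_f·ρ_L(Q,Q')`** —
  Shen–Zhu–Zhu's (4.5) with `W₂` replaced by its Kantorovich–Rubinstein (`W₁`) shadow, kernel-checked, rate `1 − 12|β'| ≥ K_𝒮 = 1 − 16|β'|`.

THEOREMS ONLY, no definition, no sorry.  HONEST FRAMING: fixed cut-off; "uniform" = in `L` at fixed `|β'| < 1/12` (strong coupling) — the route's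
scaling `β'_K → ∞` leaves this window; the `W₂` statement (4.5) is NOT proved (`shenZhuZhu_finiteVolumeErgodicity` stays undischarged); nothing
`K`-uniform; `UniformColdStartMixing` (24809, ASIDE) not restated; no crux, rung or summit statement is proved; the Yang–Mills mass gap is NOT proved.

References: H. Shen, R. Zhu, X. Zhu, CMP 400 (2023) 805–851 = arXiv:2204.12737, Thm 4.2 (4.5), (4.7)–(4.8) [ShenZhuZhu2022]; D. Bakry, I. Gentil,
M. Ledoux, Grundlehren 348 (2014), Thm 3.2.3 / (3.2.4), Thm 3.3.18 [BakryGentilLedoux2014].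
-/

set_option autoImplicit false

noncomputable section

namespace Summit.QuantumFields.YangMills.Theorems.ColdStartUniversality

open MeasureTheory ProbabilityTheory Matrix Complex Finset Filter Topology Set
open scoped ComplexConjugate BigOperators Real NNReal ENNReal
open Literature.MathematicalPhysics.QuantumFieldTheory
open Literature.MathematicalPhysics.QuantumLattice (fundamentalRep fundamentalLatticeRep continuous_fundamentalRep fundamentalRep_apply fundamentalLatticeRep_N)

variable {L : ℕ} [NeZero L]

/-! ## §1. (The Hilbert–Schmidt inequalities `hsForm_lieProj_self_le` — `|𝐩Z|² ≤ |Z|²` — and `hsForm_sum_smul_noiseDir_self` —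
`|Σ_ν c_ν E_ν|² = Σ_ν c_ν²` — are in the tree: `…ColdStartSolutionsExistTruncatedBounds`, `…BakryEmeryHessian`.) -/

/-! ## §2. Product one-parameter flows: derivative of `s ↦ f(coords(γ_s))` and the distance moved -/

section Flow

open scoped Matrix.Norms.Operator

/-- ★ **Derivative along a product one-parameter flow.**  For `X_e ∈ 𝔰𝔲(2)` (skew-Hermitian, traceless) and a differentiable `f`:
`d/ds f(coords(γ_s)) = Df(coords γ_s)[coords of (X_e (γ_s)_e)_e]`, `(γ_s)_e = e^(sX_e) V_e`. [folklore] -/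
theorem hasDerivAt_comp_coords_prodFlow_two (V : GaugeConfig 3 L (Matrix.specialUnitaryGroup (Fin 2) ℂ))
    (X : Edge 3 L → Matrix (Fin (fundamentalLatticeRep 2).N) (Fin (fundamentalLatticeRep 2).N) ℂ) (hXh : ∀ e, (X e)ᴴ = -(X e)) (hX0 : ∀ e, (X e).trace = 0)
    {f : (Edge 3 L × Fin 2 × Fin 2 × Bool → ℝ) → ℝ} (hf : Differentiable ℝ f) (s : ℝ) :
    let coords : GaugeConfig 3 L (Matrix.specialUnitaryGroup (Fin 2) ℂ) → (Edge 3 L × Fin 2 × Fin 2 × Bool → ℝ) :=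
      fun V q => (fun z : ℂ => if q.2.2.2 then z.im else z.re)
        ((fundamentalRep (Fin 2) (V q.1) : Matrix (Fin 2) (Fin 2) ℂ) q.2.1 q.2.2.1)
    let γ : ℝ → GaugeConfig 3 L (Matrix.specialUnitaryGroup (Fin 2) ℂ) := fun s e =>
      SUNBakryEmery.expSU (N := 2) (Y := Matrix.of fun i j : Fin 2 => X e i j) (hXh e) (hX0 e) s * V e
    HasDerivAt (fun s => f (coords (γ s))) (fderiv ℝ f (coords (γ s))
      (fun q : Edge 3 L × Fin 2 × Fin 2 × Bool => (fun z : ℂ => if q.2.2.2 then z.im else z.re)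
        ((X q.1 * (fundamentalLatticeRep 2).ρ (γ s q.1)) q.2.1 q.2.2.1))) s := by
  intro coords γ
  classical
  have hγcoe : ∀ s e, (fundamentalLatticeRep 2).ρ (γ s e) = NormedSpace.exp (s • X e) * (fundamentalLatticeRep 2).ρ (V e) := fun s e => rfl
  set COf : (Edge 3 L → Matrix (Fin (fundamentalLatticeRep 2).N) (Fin (fundamentalLatticeRep 2).N) ℂ) → (Edge 3 L × Fin 2 × Fin 2 × Bool → ℝ) :=
    fun Mc q => (fun z : ℂ => if q.2.2.2 then z.im else z.re) (Mc q.1 q.2.1 q.2.2.1) with hCOf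
  have hCOadd : ∀ M₁ M₂, COf (M₁ + M₂) = COf M₁ + COf M₂ := by
    intro M₁ M₂; funext q; obtain ⟨e, a, b, flag⟩ := q
    cases flag
    · change ((M₁ e a b) + (M₂ e a b)).re = (M₁ e a b).re + (M₂ e a b).re
      exact Complex.add_re _ _
    · change ((M₁ e a b) + (M₂ e a b)).im = (M₁ e a b).im + (M₂ e a b).im
      exact Complex.add_im _ _
  have hCOsmul : ∀ (t : ℝ) M₁, COf (t • M₁) = t • COf M₁ := by
    intro t M₁; funext q; obtain ⟨e, a, b, flag⟩ := q
    cases flag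
    · change (t • (M₁ e a b)).re = t * (M₁ e a b).re
      rw [Complex.smul_re, smul_eq_mul]
    · change (t • (M₁ e a b)).im = t * (M₁ e a b).im
      rw [Complex.smul_im, smul_eq_mul]
  let COl : (Edge 3 L → Matrix (Fin (fundamentalLatticeRep 2).N) (Fin (fundamentalLatticeRep 2).N) ℂ) →ₗ[ℝ] (Edge 3 L × Fin 2 × Fin 2 × Bool → ℝ) :=
    { toFun := COf, map_add' := hCOadd, map_smul' := hCOsmul }
  let CO : (Edge 3 L → Matrix (Fin (fundamentalLatticeRep 2).N) (Fin (fundamentalLatticeRep 2).N) ℂ) →L[ℝ] (Edge 3 L × Fin 2 × Fin 2 × Bool → ℝ) :=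
    LinearMap.toContinuousLinearMap COl
  have hCO : ∀ Mc, CO Mc = COf Mc := fun _ => rfl
  set P : ℝ → (Edge 3 L → Matrix (Fin (fundamentalLatticeRep 2).N) (Fin (fundamentalLatticeRep 2).N) ℂ) := fun s e =>
    NormedSpace.exp (s • X e) * (fundamentalLatticeRep 2).ρ (V e) with hP
  set P' : ℝ → (Edge 3 L → Matrix (Fin (fundamentalLatticeRep 2).N) (Fin (fundamentalLatticeRep 2).N) ℂ) := fun s e =>
    X e * NormedSpace.exp (s • X e) * (fundamentalLatticeRep 2).ρ (V e) with hP'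
  have hcoP : ∀ s, coords (γ s) = CO (P s) := fun s => by rw [hCO]; funext q; rfl
  have hPd : HasDerivAt P (P' s) s := hasDerivAt_pi.2 fun e => (hasDerivAt_exp_smul_const' (𝕂 := ℝ) (X e) s).mul_const _
  have h := (hf (CO (P s))).hasFDerivAt.comp_hasDerivAt s (CO.hasFDerivAt.comp_hasDerivAt s hPd)
  have heq : (fun s => f (coords (γ s))) = f ∘ (⇑CO) ∘ P := by funext s; simp only [Function.comp_apply, hcoP]
  have hv : CO (P' s) = fun q : Edge 3 L × Fin 2 × Fin 2 × Bool => (fun z : ℂ => if q.2.2.2 then z.im else z.re)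
      ((X q.1 * (fundamentalLatticeRep 2).ρ (γ s q.1)) q.2.1 q.2.2.1) := by
    rw [hCO]; funext q
    simp only [hCOf, hP', hγcoe, Matrix.mul_assoc]
  rw [heq, hcoP s, ← hv]
  exact h

/-- ★ **Distance moved by a product one-parameter flow**: `ρ_L(V, (e^(sX_e)V_e)_e)² ≤ s²·Σ_e |X_e|²` (`sX_e` is a logarithm on each link).
[cite: ShenZhuZhu2022, §4.1] -/
theorem torusRiemannDistSq_prodFlow_le (V : GaugeConfig 3 L (Matrix.specialUnitaryGroup (Fin 2) ℂ))
    (X : Edge 3 L → Matrix (Fin (fundamentalLatticeRep 2).N) (Fin (fundamentalLatticeRep 2).N) ℂ) (hXmem : ∀ e, X e ∈ (fundamentalLatticeRep 2).lieAlg)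
    (hXh : ∀ e, (X e)ᴴ = -(X e)) (hX0 : ∀ e, (X e).trace = 0) (s : ℝ) :
    torusRiemannDistSq (fundamentalLatticeRep 2) V
        (fun e => SUNBakryEmery.expSU (N := 2) (Y := Matrix.of fun i j : Fin 2 => X e i j) (hXh e) (hX0 e) s * V e) ≤
      s ^ 2 * ∑ e : Edge 3 L, hsForm (fundamentalLatticeRep 2).N (X e) (X e) := by
  unfold torusRiemannDistSq
  rw [Finset.mul_sum]
  refine Finset.sum_le_sum fun e _ => ?_
  -- `ρ(V_e, e^(sX_e)V_e) ≤ |s X_e| = |s|·|X_e|`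
  have hmem : (s • X e) ∈ (fundamentalLatticeRep 2).lieAlg := (fundamentalLatticeRep 2).lieAlg.smul_mem _ (hXmem e)
  have hexp : NormedSpace.exp (s • X e) * (fundamentalLatticeRep 2).ρ (V e) =
      (fundamentalLatticeRep 2).ρ (SUNBakryEmery.expSU (N := 2) (Y := Matrix.of fun i j : Fin 2 => X e i j) (hXh e) (hX0 e) s * V e) := rfl
  have hle : (fundamentalLatticeRep 2).riemannDist (V e)
      (SUNBakryEmery.expSU (N := 2) (Y := Matrix.of fun i j : Fin 2 => X e i j) (hXh e) (hX0 e) s * V e) ≤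
      Real.sqrt (hsForm (fundamentalLatticeRep 2).N (s • X e) (s • X e)) := by
    rw [LatticeRep.riemannDist]
    refine csInf_le ⟨0, ?_⟩ ⟨s • X e, ⟨hmem, hexp⟩, rfl⟩
    rintro _ ⟨Y, -, rfl⟩; exact Real.sqrt_nonneg _
  have hs : hsForm (fundamentalLatticeRep 2).N (s • X e) (s • X e) = s ^ 2 * hsForm (fundamentalLatticeRep 2).N (X e) (X e) := by
    rw [hsForm_real_smul_left, hsForm_comm, hsForm_real_smul_left]; ring
  have h0 := (fundamentalLatticeRep 2).riemannDist_nonneg (V e)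
    (SUNBakryEmery.expSU (N := 2) (Y := Matrix.of fun i j : Fin 2 => X e i j) (hXh e) (hX0 e) s * V e)
  calc (fundamentalLatticeRep 2).riemannDist (V e) (SUNBakryEmery.expSU (N := 2) (Y := Matrix.of fun i j : Fin 2 => X e i j) (hXh e) (hX0 e) s * V e) ^ 2
      ≤ Real.sqrt (hsForm (fundamentalLatticeRep 2).N (s • X e) (s • X e)) ^ 2 := pow_le_pow_left₀ h0 hle 2
    _ = s ^ 2 * hsForm (fundamentalLatticeRep 2).N (X e) (X e) := by rw [Real.sq_sqrt (hsForm_self_nonneg _), hs]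

end Flow

/-! ## §3. Lipschitz in `ρ_L` implies a bounded carré du champ -/

/-- The coordinate vector of `((Σ_ν √2 a_(e,ν) 𝐩(E_ν)) V_e)_e` is `Σ_n a_n σ_n(V)`. [folklore] -/
theorem coordVec_sum_smul_lieProj_two (V : GaugeConfig 3 L (Matrix.specialUnitaryGroup (Fin 2) ℂ)) (a : Edge 3 L × NoiseIdx (fundamentalLatticeRep 2).N → ℝ) :
    (fun q : Edge 3 L × Fin 2 × Fin 2 × Bool => (fun z : ℂ => if q.2.2.2 then z.im else z.re)
        (((∑ m : NoiseIdx (fundamentalLatticeRep 2).N, (a (q.1, m) * Real.sqrt 2) • (fundamentalLatticeRep 2).lieProj (noiseDir m)) *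
          (fundamentalLatticeRep 2).ρ (V q.1)) q.2.1 q.2.2.1)) =
      ∑ n : Edge 3 L × NoiseIdx (fundamentalLatticeRep 2).N, a n • (fun q : Edge 3 L × Fin (fundamentalLatticeRep 2).N × Fin (fundamentalLatticeRep 2).N × Bool =>
        if n.1 = q.1 then (fun z : ℂ => if q.2.2.2 then z.im else z.re) (((Real.sqrt 2 : ℂ) • ((fundamentalLatticeRep 2).lieProj (noiseDir n.2) *
          (fundamentalLatticeRep 2).ρ (V q.1))) q.2.1 q.2.2.1) else 0) := by
  classical
  set Y : Edge 3 L → Matrix (Fin (fundamentalLatticeRep 2).N) (Fin (fundamentalLatticeRep 2).N) ℂ := fun e =>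
    ∑ m : NoiseIdx (fundamentalLatticeRep 2).N, (a (e, m) * Real.sqrt 2) • (fundamentalLatticeRep 2).lieProj (noiseDir m) with hY
  show (fun q : Edge 3 L × Fin 2 × Fin 2 × Bool => (fun z : ℂ => if q.2.2.2 then z.im else z.re)
        ((Y q.1 * (fundamentalLatticeRep 2).ρ (V q.1)) q.2.1 q.2.2.1)) = _
  funext q
  obtain ⟨e, i, j, flag⟩ := q
  rw [Finset.sum_apply]
  simp only [Pi.smul_apply, smul_eq_mul]
  rw [Fintype.sum_prod_type, Finset.sum_comm]
  have hcol : ∀ m : NoiseIdx (fundamentalLatticeRep 2).N, ∑ e' : Edge 3 L, a (e', m) *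
      (if ((e', m) : Edge 3 L × NoiseIdx (fundamentalLatticeRep 2).N).1 = ((e, i, j, flag) : Edge 3 L × Fin (fundamentalLatticeRep 2).N × Fin (fundamentalLatticeRep 2).N × Bool).1 then
        (fun z : ℂ => if flag then z.im else z.re) (((Real.sqrt 2 : ℂ) • ((fundamentalLatticeRep 2).lieProj (noiseDir m) *
          (fundamentalLatticeRep 2).ρ (V e))) i j) else 0) =
      a (e, m) * (fun z : ℂ => if flag then z.im else z.re) (((Real.sqrt 2 : ℂ) • ((fundamentalLatticeRep 2).lieProj (noiseDir m) *
          (fundamentalLatticeRep 2).ρ (V e))) i j) := by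
    intro m
    rw [Finset.sum_eq_single e]
    · simp only [if_true]
    · intro e' _ hne
      simp only [if_neg hne, mul_zero]
    · intro h; exact absurd (Finset.mem_univ e) h
  simp only [hcol]
  have hentry : (Y e * (fundamentalLatticeRep 2).ρ (V e)) i j =
      ∑ m : NoiseIdx (fundamentalLatticeRep 2).N, ((a (e, m) * Real.sqrt 2 : ℝ) : ℂ) *
        (((fundamentalLatticeRep 2).lieProj (noiseDir m) * (fundamentalLatticeRep 2).ρ (V e)) i j) := by
    rw [hY, Finset.sum_mul, Matrix.sum_apply]
    refine Finset.sum_congr rfl fun m _ => ?_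
    rw [Matrix.smul_mul, Matrix.smul_apply, Complex.real_smul]
  rw [hentry]
  cases flag
  · simp only [Bool.false_eq_true, if_false, Complex.re_sum, Matrix.smul_apply, Complex.re_ofReal_mul, smul_eq_mul]
    refine Finset.sum_congr rfl fun m _ => ?_
    ring
  · simp only [if_true, Complex.im_sum, Matrix.smul_apply, Complex.im_ofReal_mul, smul_eq_mul]
    refine Finset.sum_congr rfl fun m _ => ?_
    ring

/-- ★★ **`ρ_L`-Lipschitz ⇒ `Γ^A ≤ 2·Lip²`.**  If a differentiable function `f` of the real link coordinates satisfies
`|f(coords Q') − f(coords Q)| ≤ L_f·ρ_L(Q,Q')` for all `Q, Q' ∈ SU(2)^E`, then `Γ^A(f)(V) ≤ 2 L_f²` at every `V` (test the bound along the product flow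
generated by the Riemannian gradient itself). [cite: BakryGentilLedoux2014, §1.11 and (3.2.4)] -/
theorem carre_le_two_mul_sq_of_riemannLipschitz (β' : ℝ) {f : (Edge 3 L × Fin 2 × Fin 2 × Bool → ℝ) → ℝ} (hf : Differentiable ℝ f)
    {Lf : ℝ} (hLf : 0 ≤ Lf) :
    let coords : GaugeConfig 3 L (Matrix.specialUnitaryGroup (Fin 2) ℂ) → (Edge 3 L × Fin 2 × Fin 2 × Bool → ℝ) :=
      fun V q => (fun z : ℂ => if q.2.2.2 then z.im else z.re)
        ((fundamentalRep (Fin 2) (V q.1) : Matrix (Fin 2) (Fin 2) ℂ) q.2.1 q.2.2.1)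
    let A : GaugeConfig 3 L (Matrix.specialUnitaryGroup (Fin 2) ℂ) → (Edge 3 L × Fin 2 × Fin 2 × Bool) →
        (Edge 3 L × Fin 2 × Fin 2 × Bool) → ℝ := fun V i j =>
      ∑ n : Edge 3 L × NoiseIdx 2,
        (if n.1 = i.1 then (fun z : ℂ => if i.2.2.2 then z.im else z.re)
          ((latticeLangevinDynamics (fundamentalLatticeRep 2) β').noise
            (matrixConfig (fundamentalRep (Fin 2)) V) i.1 n.2 i.2.1 i.2.2.1) else 0) *
        (if n.1 = j.1 then (fun z : ℂ => if j.2.2.2 then z.im else z.re)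
          ((latticeLangevinDynamics (fundamentalLatticeRep 2) β').noise
            (matrixConfig (fundamentalRep (Fin 2)) V) j.1 n.2 j.2.1 j.2.2.1) else 0)
    (∀ Q Q' : GaugeConfig 3 L (Matrix.specialUnitaryGroup (Fin 2) ℂ),
      |f (coords Q') - f (coords Q)| ≤ Lf * Real.sqrt (torusRiemannDistSq (fundamentalLatticeRep 2) Q Q')) →
    ∀ V, (∑ i : Edge 3 L × Fin 2 × Fin 2 × Bool, ∑ j : Edge 3 L × Fin 2 × Fin 2 × Bool,
        fderiv ℝ f (coords V) (Pi.single i 1) * fderiv ℝ f (coords V) (Pi.single j 1) * A V i j) ≤ 2 * Lf ^ 2 := by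
  intro coords A hlip V
  classical
  -- the frame derivatives `D_n = Df(coords V)[σ_n(V)]` and the carré du champ `G = Σ D_n²`
  set D : Edge 3 L × NoiseIdx (fundamentalLatticeRep 2).N → ℝ := fun n => fderiv ℝ f (coords V)
    (fun q : Edge 3 L × Fin (fundamentalLatticeRep 2).N × Fin (fundamentalLatticeRep 2).N × Bool =>
      if n.1 = q.1 then (fun z : ℂ => if q.2.2.2 then z.im else z.re) (((Real.sqrt 2 : ℂ) • ((fundamentalLatticeRep 2).lieProj (noiseDir n.2) *
        (fundamentalLatticeRep 2).ρ (V q.1))) q.2.1 q.2.2.1) else 0) with hD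
  have hG : (∑ i : Edge 3 L × Fin 2 × Fin 2 × Bool, ∑ j : Edge 3 L × Fin 2 × Fin 2 × Bool,
      fderiv ℝ f (coords V) (Pi.single i 1) * fderiv ℝ f (coords V) (Pi.single j 1) * A V i j) = ∑ n, D n ^ 2 :=
    carre_eq_sum_sq_frame_two β' f V
  rw [hG]
  set G : ℝ := ∑ n, D n ^ 2 with hGdef
  have hG0 : 0 ≤ G := Finset.sum_nonneg fun n _ => sq_nonneg _
  -- the gradient direction `X_e = Σ_ν √2 D_(e,ν) 𝐩(E_ν) ∈ 𝔰𝔲(2)`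
  set X : Edge 3 L → Matrix (Fin (fundamentalLatticeRep 2).N) (Fin (fundamentalLatticeRep 2).N) ℂ := fun e =>
    ∑ m : NoiseIdx (fundamentalLatticeRep 2).N, (D (e, m) * Real.sqrt 2) • (fundamentalLatticeRep 2).lieProj (noiseDir m) with hXdef
  have hXmem : ∀ e, X e ∈ (fundamentalLatticeRep 2).lieAlg := fun e =>
    Submodule.sum_mem _ fun m _ => (fundamentalLatticeRep 2).lieAlg.smul_mem _ ((fundamentalLatticeRep 2).lieProj_mem _)
  have hXh : ∀ e, (X e)ᴴ = -(X e) := fun e => by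
    rw [← Matrix.star_eq_conjTranspose]; exact (fundamentalLatticeRep 2).star_eq_neg_of_mem_lieAlg (hXmem e)
  have hX0 : ∀ e, (X e).trace = 0 := fun e => trace_eq_zero_of_mem_lieAlg_two (hXmem e)
  have hXproj : ∀ e, X e = (fundamentalLatticeRep 2).lieProj (∑ m : NoiseIdx (fundamentalLatticeRep 2).N, (D (e, m) * Real.sqrt 2) • noiseDir m) := fun e => by
    rw [map_sum]; simp_rw [map_smul]; rfl
  have hXnorm : ∑ e : Edge 3 L, hsForm (fundamentalLatticeRep 2).N (X e) (X e) ≤ 2 * G := by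
    calc ∑ e : Edge 3 L, hsForm (fundamentalLatticeRep 2).N (X e) (X e)
        ≤ ∑ e : Edge 3 L, ∑ m : NoiseIdx (fundamentalLatticeRep 2).N, (D (e, m) * Real.sqrt 2) ^ 2 :=
          Finset.sum_le_sum fun e _ => by rw [hXproj, ← hsForm_sum_smul_noiseDir_self]; exact hsForm_lieProj_self_le _ _
      _ = 2 * G := by
          rw [hGdef]
          conv_rhs => rw [Fintype.sum_prod_type, Finset.mul_sum]
          refine Finset.sum_congr rfl fun e _ => ?_
          rw [Finset.mul_sum]
          exact Finset.sum_congr rfl fun m _ => by rw [mul_pow, Real.sq_sqrt (by norm_num : (0:ℝ) ≤ 2)]; ring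
  -- the flow along `X` and the derivative of `f ∘ coords` along it at `s = 0`
  set γ : ℝ → GaugeConfig 3 L (Matrix.specialUnitaryGroup (Fin 2) ℂ) := fun s e =>
    SUNBakryEmery.expSU (N := 2) (Y := Matrix.of fun i j : Fin 2 => X e i j) (hXh e) (hX0 e) s * V e with hγ
  have hγ0 : γ 0 = V := by
    funext e; apply Subtype.ext
    change NormedSpace.exp ((0 : ℝ) • X e) * (fundamentalLatticeRep 2).ρ (V e) = (fundamentalLatticeRep 2).ρ (V e)
    rw [zero_smul, NormedSpace.exp_zero, Matrix.one_mul]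
  have hder : HasDerivAt (fun s => f (coords (γ s))) (fderiv ℝ f (coords (γ 0))
      (fun q : Edge 3 L × Fin 2 × Fin 2 × Bool => (fun z : ℂ => if q.2.2.2 then z.im else z.re)
        ((X q.1 * (fundamentalLatticeRep 2).ρ (γ 0 q.1)) q.2.1 q.2.2.1))) 0 :=
    hasDerivAt_comp_coords_prodFlow_two V X hXh hX0 hf 0
  have hvec : (fun q : Edge 3 L × Fin 2 × Fin 2 × Bool => (fun z : ℂ => if q.2.2.2 then z.im else z.re)
      ((X q.1 * (fundamentalLatticeRep 2).ρ (γ 0 q.1)) q.2.1 q.2.2.1)) =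
      ∑ n : Edge 3 L × NoiseIdx (fundamentalLatticeRep 2).N, D n • (fun q : Edge 3 L × Fin (fundamentalLatticeRep 2).N × Fin (fundamentalLatticeRep 2).N × Bool =>
        if n.1 = q.1 then (fun z : ℂ => if q.2.2.2 then z.im else z.re) (((Real.sqrt 2 : ℂ) • ((fundamentalLatticeRep 2).lieProj (noiseDir n.2) *
          (fundamentalLatticeRep 2).ρ (V q.1))) q.2.1 q.2.2.1) else 0) := by
    rw [hγ0]; exact coordVec_sum_smul_lieProj_two V D
  set Λ : (Edge 3 L × Fin (fundamentalLatticeRep 2).N × Fin (fundamentalLatticeRep 2).N × Bool → ℝ) →L[ℝ] ℝ := fderiv ℝ f (coords V) with hΛ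
  have hval : fderiv ℝ f (coords (γ 0)) (fun q : Edge 3 L × Fin 2 × Fin 2 × Bool => (fun z : ℂ => if q.2.2.2 then z.im else z.re)
      ((X q.1 * (fundamentalLatticeRep 2).ρ (γ 0 q.1)) q.2.1 q.2.2.1)) = G := by
    rw [hvec, hγ0]
    change Λ (∑ n : Edge 3 L × NoiseIdx (fundamentalLatticeRep 2).N, D n • (fun q : Edge 3 L × Fin (fundamentalLatticeRep 2).N × Fin (fundamentalLatticeRep 2).N × Bool =>
        if n.1 = q.1 then (fun z : ℂ => if q.2.2.2 then z.im else z.re) (((Real.sqrt 2 : ℂ) • ((fundamentalLatticeRep 2).lieProj (noiseDir n.2) *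
          (fundamentalLatticeRep 2).ρ (V q.1))) q.2.1 q.2.2.1) else 0)) = G
    rw [map_sum, hGdef]
    refine Finset.sum_congr rfl fun n _ => ?_
    rw [map_smul, smul_eq_mul, sq]
    rfl
  replace hder := hder.congr_deriv hval
  -- the Lipschitz bound along the flow
  have hC0 : 0 ≤ Lf * Real.sqrt (2 * G) := by positivity
  have hlipflow : ∀ᶠ s in 𝓝 (0 : ℝ), ‖f (coords (γ s)) - f (coords (γ 0))‖ ≤ Lf * Real.sqrt (2 * G) * ‖s - 0‖ := by
    refine Filter.Eventually.of_forall fun s => ?_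
    rw [sub_zero, Real.norm_eq_abs, Real.norm_eq_abs, hγ0]
    have h1 := hlip V (γ s)
    have h2 : Real.sqrt (torusRiemannDistSq (fundamentalLatticeRep 2) V (γ s)) ≤ |s| * Real.sqrt (2 * G) := by
      calc Real.sqrt (torusRiemannDistSq (fundamentalLatticeRep 2) V (γ s))
          ≤ Real.sqrt (s ^ 2 * (2 * G)) := Real.sqrt_le_sqrt ((torusRiemannDistSq_prodFlow_le V X hXmem hXh hX0 s).trans
              (mul_le_mul_of_nonneg_left hXnorm (sq_nonneg s)))
        _ = |s| * Real.sqrt (2 * G) := by rw [Real.sqrt_mul (sq_nonneg s), Real.sqrt_sq_eq_abs]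
    calc |f (coords (γ s)) - f (coords V)| ≤ Lf * Real.sqrt (torusRiemannDistSq (fundamentalLatticeRep 2) V (γ s)) := h1
      _ ≤ Lf * (|s| * Real.sqrt (2 * G)) := mul_le_mul_of_nonneg_left h2 hLf
      _ = Lf * Real.sqrt (2 * G) * |s| := by ring
  have hGle : G ≤ Lf * Real.sqrt (2 * G) := by
    have h := hder.le_of_lip' hC0 hlipflow
    rw [Real.norm_eq_abs, abs_of_nonneg hG0] at h
    exact h
  -- `G ≤ L_f √(2G)` ⇒ `G ≤ 2 L_f²`
  by_contra hcon
  push Not at hcon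
  have hGpos : 0 < G := lt_of_le_of_lt (by positivity) hcon
  have hsq : G ^ 2 ≤ Lf ^ 2 * (2 * G) := by
    calc G ^ 2 ≤ (Lf * Real.sqrt (2 * G)) ^ 2 := pow_le_pow_left₀ hG0 hGle 2
      _ = Lf ^ 2 * (2 * G) := by rw [mul_pow, Real.sq_sqrt (by positivity)]
  nlinarith

/-! ## §4. The contraction of the `ρ_L`-Lipschitz seminorm -/

/-- ★★★ **Shen–Zhu–Zhu's Theorem 4.2 (4.5) as a contraction of the `ρ_L`-Lipschitz seminorm, uniformly in the volume.**  At `|β'| < 1/12`, for every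
torus size `L`, every realising Markov kernel family `κ_t(x,·) = law(U_t^x)` of the `SU(2)` lattice Langevin dynamics on `(ℤ/L)³`, every `C⁵` function
`f` of the real link coordinates which is `L_f`-Lipschitz for Shen–Zhu–Zhu's product Riemannian distance `ρ_L = √(torusRiemannDistSq)` on `SU(2)^E`,
every `t ≥ 0` and all `Q, Q'`:  `|∫ f∘coords dκ_t(Q) − ∫ f∘coords dκ_t(Q')| ≤ e^(−(1−12|β'|)t) · L_f · ρ_L(Q,Q')`, i.e.
`Lip_(ρ_L)(P_t F) ≤ e^(−(1−12|β'|)t) · Lip_(ρ_L)(F)` — the Kantorovich–Rubinstein (`W₁`) shadow of (4.5), rate `1 − 12|β'| ≥ K_𝒮`.  The `W₂` form is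
NOT proved; the Yang–Mills mass gap is NOT proved. [cite: ShenZhuZhu2022, Theorem 4.2 (4.5)] -/
theorem wilson_riemannLipschitz_contraction_uniform (L : ℕ) [NeZero L] (Q Q' : GaugeConfig 3 L (Matrix.specialUnitaryGroup (Fin 2) ℂ)) (t : ℝ≥0)
    {Lf : ℝ} (hLf : 0 ≤ Lf) (β' : ℝ) (hβ : |β'| < 1 / 12)
    (κ : ℝ≥0 → Kernel (GaugeConfig 3 L (Matrix.specialUnitaryGroup (Fin 2) ℂ))
      (GaugeConfig 3 L (Matrix.specialUnitaryGroup (Fin 2) ℂ))) [∀ t, IsMarkovKernel (κ t)]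
    (hreal : ∀ (t : ℝ≥0) (x : GaugeConfig 3 L (Matrix.specialUnitaryGroup (Fin 2) ℂ))
        (Ω : Type) [MeasurableSpace Ω] (P : Measure Ω) [IsProbabilityMeasure P]
        (W : ℝ≥0 → Ω → (Edge 3 L × NoiseIdx 2 → ℝ)) (hW : IsFlatBrownian W P)
        (U : ℝ≥0 → Ω → GaugeConfig 3 L (Matrix.specialUnitaryGroup (Fin 2) ℂ)),
        (∀ ω, U 0 ω = x) →
        (latticeLangevinDynamics (fundamentalLatticeRep 2) β').IsSolution (fundamentalRep (Fin 2))
          hW.natFiltration P W U →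
        κ t x = P.map (U t))
    {f : (Edge 3 L × Fin 2 × Fin 2 × Bool → ℝ) → ℝ} (hf : ContDiff ℝ 5 f) :
    let coords : GaugeConfig 3 L (Matrix.specialUnitaryGroup (Fin 2) ℂ) → (Edge 3 L × Fin 2 × Fin 2 × Bool → ℝ) :=
      fun V q => (fun z : ℂ => if q.2.2.2 then z.im else z.re)
        ((fundamentalRep (Fin 2) (V q.1) : Matrix (Fin 2) (Fin 2) ℂ) q.2.1 q.2.2.1)
    (∀ Q Q' : GaugeConfig 3 L (Matrix.specialUnitaryGroup (Fin 2) ℂ),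
      |f (coords Q') - f (coords Q)| ≤ Lf * Real.sqrt (torusRiemannDistSq (fundamentalLatticeRep 2) Q Q')) →
      |∫ y, f (coords y) ∂(κ t Q) - ∫ y, f (coords y) ∂(κ t Q')| ≤
        Real.exp (-((1 - 12 * |β'|) * (t : ℝ))) * Lf * Real.sqrt (torusRiemannDistSq (fundamentalLatticeRep 2) Q Q') := by
  intro coords hlip
  have hΓ := carre_le_two_mul_sq_of_riemannLipschitz (L := L) β' (hf.differentiable (by norm_num)) hLf hlip
  obtain ⟨g, hg, -, hgrep, hbound⟩ := wilson_lipschitz_contraction_uniform L β' hβ κ hreal hf t hΓ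
  have hlipg := abs_sub_le_sqrt_carre_mul_sqrt_torusRiemannDistSq L β' (hg.differentiable (by norm_num)) hbound Q Q'
  have hs : Real.sqrt (Real.exp (-(2 * (1 - 12 * |β'|) * (t : ℝ))) * (2 * Lf ^ 2) / 2) = Real.exp (-((1 - 12 * |β'|) * (t : ℝ))) * Lf := by
    have he : Real.exp (-(2 * (1 - 12 * |β'|) * (t : ℝ))) = Real.exp (-((1 - 12 * |β'|) * (t : ℝ))) ^ 2 := by
      rw [← Real.exp_nat_mul]; congr 1; ring
    rw [he, show Real.exp (-((1 - 12 * |β'|) * (t : ℝ))) ^ 2 * (2 * Lf ^ 2) / 2 = (Real.exp (-((1 - 12 * |β'|) * (t : ℝ))) * Lf) ^ 2 by ring,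
      Real.sqrt_sq (by positivity)]
  rw [hs] at hlipg
  rw [hgrep Q, hgrep Q', abs_sub_comm]
  exact hlipg

end Summit.QuantumFields.YangMills.Theorems.ColdStartUniversality

end
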